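import Literature.Geometry.ComplexAnalytic.RelativeExponentialUniformisation   -- ★ P-1 (U6-a): prefix currency `basePoint`, `totalOver`, `ComplexTorus`, `cover`
import Literature.Geometry.ComplexAnalytic.RelativeDoublingDatum             -- ★ p849240 B1 «DOUBLING» (A-p15 (g19); (i) p849091, (D3) p849174 inside)
import Literature.Geometry.ComplexAnalytic.DoublingLinearisingChart         -- ★ p849248 B2 «LINCHART» (LA7-p02 (g2); (a) p849219 + ★ O3 p849119 `KoenigsLinearization` inside)
import Literature.Geometry.ComplexAnalytic.DoublingChartExtension           -- ★ p849077 B3 «EXTEND» (LA5-p02 (g2))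
import Literature.NumberTheory.Transcendental.AnalytificationMorphismSmooth -- ★ p849091 `IsAnalytification.contMDiff_comp_map`
import Literature.AlgebraicGeometry.AbelianSchemes.AbelianSchemeTotalSpaceSmoothProjective -- ★ `smoothOfRelativeDimension_total`
import Literature.Geometry.Kaehler.ComplexTorusDoublingEquivariantLift     -- ★ p849045 B4 «DBLADD» (LA7-p01 (g0))
import Literature.Geometry.Kaehler.ComplexTorusAverage                     -- ★ `ComplexTorus.cover_zero`
import HarnessLib

/-!
# The relative exponential FLOW of an abelian scheme over `ℂ` — UNBUNDLED (seven conjuncts), by the DOUBLING ∕ KŒNIGS road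

Topic `Literature/Geometry/ComplexAnalytic`; namespace `Literature.Geometry.ComplexAnalytic`.  THEOREMS ONLY (no `def`, no `structure`,
no `instance`, no notation).  Cell `hodgecm-mathlib` (D-0151), FLOOR 0, P6 «MOD» (crux hLiu418 = stmt-HodgeConjecture-24832, `--supports`,
count-neutral); «L8-PREP» ENDGAME module (E1) of LA1-plan (g2)'s memo `F0/P6/L1/LA1-plan/g2/StubRELEXP.endgame.v1.md` 7cb2952c §1 —
the HOME seam `IsRelExpFlowOn` of the closer skeleton is packaging only and is NOT filed; this module states its seven fields as
conjuncts over the binder prefix of ★ P-1 `relativeExponentialUniformisation` (★ :282–:289 verbatim) and proves them by ROAD B of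
LA7-plan (g2)'s skeleton `F0/P6/L7/LA7-plan/g2/StubFLOW.roadB.skeleton.v5.lean` 8d65a6cd (head `RoadB.stub_FLOW_of_roadB`, re-targeted).
HC_CM is proved only modulo the 7 printed citations (2 remaining: hLiu418 = stmt-HodgeConjecture-24832, h413 = stmt-HodgeConjecture-24833)
until rung 0 closes; this file is a Literature theorem and changes no count (LEAD «M-64» (3): P-1 stays PRINTED this ramp).

THE MATHEMATICS ([MumfordAV1970] §1 (1)–(2); [DeligneHodgeII1971] §4.4 (4.4.2) p. 50).  For an abelian scheme `A → S` over a smooth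
separated `ℂ`-scheme `S`, with analytifications `MS = S^an`, `MA = A^an` and analytic projection `basePoint : MA → MS`, the relative
exponential `ex : MS × ℂ^g → MA` near any `m ∈ MS` — holomorphic, over `basePoint`, normalised at the identity section, étale, with the
translation law and onto the fibres — is built WITHOUT Lie theory from the analytified doubling map `[2] : A → A`:
(B1) ★ p849240 `exists_relative_doubling_datum` — `two = [2]^an` (`C^ω`, étale: [BLRNeronModels1990] §7.3 Lemma 2 (b)), the identity section
`zero`, and on every fibre a doubling-equivariant uniformisation `π_u : ℂ^g → A_u^an` (★ (U) + GAGA);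
(B2) ★ p849248 `exists_linearising_chart` — POINCARÉ–KŒNIGS WITH PARAMETERS ([Koenigs1884]; [Sternberg1957]; [Milnor2006] Thm. 8.2, Cor. 8.4):
a `basePoint`-adapted holomorphic chart `Θ` at `zero m` conjugating `two` to `(b, w) ↦ (b, 2w)`;
(B3) ★ `exists_equivariant_extension` — `ex (u, z) := two^[k] (Θ⁻¹ (u, 2^{-k} z))`, the `[2^k]`-iteration logarithm run backwards
([Bourbaki1989LieGroups13] Ch. III §7 no. 6; [Tate1967] §2.3);
(B4) ★ `exists_linear_of_doubling_equivariant` — on each fibre `ex (u, ·) = π_u ∘ L_u` with `L_u` linear (a doubling-equivariant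
holomorphic germ between uniformisations is linear), whence the translation law, surjectivity and the normalisation.

* `exists_relExpFlow` — THE HEAD: the seven fields of the relative exponential flow near every `m : MS`.

## References
* [MumfordAV1970] D. Mumford, *Abelian Varieties* (1970), §1 (1)–(2); §4 (iv).
* [DeligneHodgeII1971] P. Deligne, *Théorie de Hodge II*, Publ. Math. IHÉS 40 (1971), §4.4 (4.4.2) p. 50.
* [BLRNeronModels1990] S. Bosch, W. Lütkebohmert, M. Raynaud, *Néron Models* (1990), §7.3 Lemma 2 (b).
* [Milnor2006] J. Milnor, *Dynamics in One Complex Variable*, 3rd ed. (2006), §8 Thm. 8.2, Cor. 8.4.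
* [Koenigs1884] G. Kœnigs, *Recherches sur les intégrales de certaines équations fonctionnelles*, Ann. sci. ÉNS (3) 1 (1884).
* [Sternberg1957] S. Sternberg, *Local contractions and a theorem of Poincaré*, Amer. J. Math. 79 (1957).
* [Bourbaki1989LieGroups13] N. Bourbaki, *Lie Groups and Lie Algebras*, Ch. III §7 no. 6.
* [Tate1967] J. Tate, *p-divisible groups* (1967), §2.3.
-/

set_option autoImplicit false

noncomputable section

open scoped Manifold ContDiff Topology
open Set Function CategoryTheory CategoryTheory.Limits AlgebraicGeometry
open Literature.Geometry.Kaehler (ComplexTorus)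
open Literature.Geometry.Kaehler.ComplexTorus (cover)
open Literature.NumberTheory.Transcendental (IsAnalytification)
open Literature.AlgebraicGeometry.Motives (SchemeOver AlgPoints ComplexPoints)
open Literature.AlgebraicGeometry.AbelianSchemes (AbelianSchemeOver)

namespace Literature.Geometry.ComplexAnalytic

/-- **The relative exponential flow (unbundled).**  For an abelian scheme `A` of relative dimension `g` over a smooth separated
`ℂ`-scheme `S` of dimension `d`, analytifications `φS : MS → S(ℂ)`, `φA : MA → A(ℂ)`, and every `m : MS`: an open `U ∋ m` and
`ex : MS × ℂ^g → MA`, `C^ω` on `U × ℂ^g`, over `basePoint`, with `ex (u, 0)` the identity of `A_{φS u}`, bijective complex differential on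
`U × ℂ^g`, the translation law `ex (u, z) = ex (u, z') ↔ ex (u, z' - z) = ex (u, 0)`, and onto every fibre over `U`.  Proof: road B
(doubling datum ★, Kœnigs linearising chart ★, equivariant extension ★, linearity on the fibres ★) — see the module docstring.
[cite: MumfordAV1970, §1 (1)–(2); §4 (iv)] [cite: DeligneHodgeII1971, §4.4 (4.4.2) p. 50] [cite: Milnor2006, Thm. 8.2, Cor. 8.4]
[cite: Bourbaki1989LieGroups13, Ch. III §7 no. 6] -/
theorem exists_relExpFlow
    (S : SchemeOver ℂ) (d : ℕ) [LocallyOfFiniteType S.hom] [IsSeparated S.hom] [SmoothOfRelativeDimension d S.hom]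
    (A : AbelianSchemeOver S.left) (g : ℕ) (hA : A.IsOfRelDim g)
    (MS : Type) [TopologicalSpace MS] [ChartedSpace (Fin d → ℂ) MS] [IsManifold 𝓘(ℂ, Fin d → ℂ) ω MS]
    (φS : MS → ComplexPoints S) (hS : IsAnalytification (Fin d → ℂ) S d φS)
    (MA : Type) [TopologicalSpace MA] [ChartedSpace (Fin (d + g) → ℂ) MA] [IsManifold 𝓘(ℂ, Fin (d + g) → ℂ) ω MA]
    (φA : MA → ComplexPoints (totalOver S A)) (hφA : IsAnalytification (Fin (d + g) → ℂ) (totalOver S A) (d + g) φA)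
    (m : MS) :
    ∃ U : Set MS, m ∈ U ∧ ∃ ex : MS × (Fin g → ℂ) → MA,
      IsOpen U ∧
      ContMDiffOn (𝓘(ℂ, Fin d → ℂ).prod 𝓘(ℂ, Fin g → ℂ)) 𝓘(ℂ, Fin (d + g) → ℂ) ω ex (U ×ˢ (univ : Set (Fin g → ℂ))) ∧
      (∀ u ∈ U, ∀ z : Fin g → ℂ, basePoint hS A φA (ex (u, z)) = u) ∧
      (∀ u ∈ U, (φA (ex (u, 0))).left = A.fibrePointToLeft (φS u).left 1) ∧
      (∀ q ∈ U ×ˢ (univ : Set (Fin g → ℂ)),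
        Bijective (mfderiv (𝓘(ℂ, Fin d → ℂ).prod 𝓘(ℂ, Fin g → ℂ)) 𝓘(ℂ, Fin (d + g) → ℂ) ex q)) ∧
      (∀ u ∈ U, ∀ z z' : Fin g → ℂ, ex (u, z) = ex (u, z') ↔ ex (u, z' - z) = ex (u, 0)) ∧
      (∀ a : MA, basePoint hS A φA a ∈ U → ∃ z : Fin g → ℂ, ex (basePoint hS A φA a, z) = a) := by
  classical
  -- (B1) the relative doubling datum — ★ p849240 `exists_relative_doubling_datum` (A-p15 (g19)) BY NAME
  obtain ⟨two, zero, htwo, hzero, hbp_two, hbp_zero, htwo_zero, hbij, hfib⟩ :=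
    exists_relative_doubling_datum S d A g hA MS φS hS MA φA hφA
  -- the fibre uniformisations feeding (B2)
  have hπ : ∀ u : MS, ∃ π : (Fin g → ℂ) → MA,
      MDifferentiable 𝓘(ℂ, Fin g → ℂ) 𝓘(ℂ, Fin (d + g) → ℂ) π ∧ π 0 = zero u ∧
      (∀ z : Fin g → ℂ, basePoint hS A φA (π z) = u) ∧ (∀ z : Fin g → ℂ, two (π z) = π ((2 : ℂ) • z)) ∧
      Injective (mfderiv 𝓘(ℂ, Fin g → ℂ) 𝓘(ℂ, Fin (d + g) → ℂ) π 0) := by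
    intro u
    obtain ⟨Φ₀, π, φu, hπd, hπinj, hπ0, hbpπ, -, -, h2π, -⟩ := hfib u
    exact ⟨π, hπd, hπ0, hbpπ, h2π, hπinj 0⟩
  -- (B2) the linearising chart at `zero m` — ★ p849248 `DoublingLinearisingChart.exists_linearising_chart` (LA7-p02 (g2)) BY NAME
  haveI := A.isProper
  haveI : SmoothOfRelativeDimension (d + g) (totalOver S A).hom :=
    Literature.AlgebraicGeometry.AbelianSchemes.AbelianSchemeOver.smoothOfRelativeDimension_total A hA
  haveI : Smooth (totalOver S A).hom := SmoothOfRelativeDimension.smooth (d + g) _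
  haveI : LocallyOfFiniteType (totalOver S A).hom := inferInstance
  have hp : ContMDiff 𝓘(ℂ, Fin (d + g) → ℂ) 𝓘(ℂ, Fin d → ℂ) ω (basePoint hS A φA) :=
    IsAnalytification.contMDiff_comp_map hφA hS (projOver S A) (basePoint hS A φA) (funext (apply_basePoint hS A φA))
  have hdim : Module.finrank ℂ (Fin (d + g) → ℂ) = Module.finrank ℂ (Fin d → ℂ) + Module.finrank ℂ (Fin g → ℂ) := by
    simp
  obtain ⟨Θ, hmΘ, hΘ, hΘsymm, hΘ1, hΘzero, hΘtwo⟩ :=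
    DoublingLinearisingChart.exists_linearising_chart (basePoint hS A φA) two zero m (c := (2 : ℂ)) (by norm_num)
      hdim hp htwo hzero hbp_two hbp_zero htwo_zero hπ
  -- (B3) the relative exponential as a map (★ p849077)
  obtain ⟨U, ex, ρ, hUopen, hmU, hρ, hexω, hbp_ex, hex0, h2ex, hexbij, hUρ, hexΘ⟩ :=
    Literature.Geometry.ComplexAnalytic.DoublingChartExtension.exists_equivariant_extension (basePoint hS A φA) two zero Θ m
      (c := (2 : ℂ)) (by norm_num) htwo hbij hbp_two hzero.continuous htwo_zero hmΘ hΘ hΘsymm hΘ1 hΘzero hΘtwo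
  -- `MA` is Hausdorff: `A → S → Spec ℂ` is separated
  haveI := A.isProper
  haveI : IsSeparated (totalOver S A).hom :=
    MorphismProperty.comp_mem @IsSeparated A.X.hom S.hom (inferInstanceAs (IsSeparated A.X.hom)) ‹IsSeparated S.hom›
  haveI : T2Space (ComplexPoints (totalOver S A)) :=
    Literature.AlgebraicGeometry.Motives.ComplexPoints.t2Space_of_isSeparated _
  haveI : T2Space MA := hφA.homeomorph.symm.t2Space
  -- B4 on every fibre over `U`: `ex (u, ·) = π_u ∘ L_u`
  have hlin : ∀ u ∈ U, ∃ (Φ₀ : (Fin g ⊕ Fin g → ℝ) ≃L[ℝ] (Fin g → ℂ)) (π : (Fin g → ℂ) → MA)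
      (φu : ComplexTorus Φ₀ → (A.fibre (φS u).left).toAbelianVariety.Points ℂ) (L : (Fin g → ℂ) ≃L[ℂ] (Fin g → ℂ)),
      (∀ z z' : Fin g → ℂ, π z = π z' ↔ ∃ k : Fin g ⊕ Fin g → ℤ, z' = z + Φ₀ (fun i => (k i : ℝ))) ∧
      (∀ a : MA, basePoint hS A φA a = u → ∃ z : Fin g → ℂ, π z = a) ∧
      IsAnalytification (Fin g → ℂ) (A.fibre (φS u).left).toAbelianVariety.X g φu ∧
      (∀ x y, φu (x + y) = φu x * φu y) ∧
      (∀ z : Fin g → ℂ, (φA (π z)).left = A.fibrePointToLeft (φS u).left (φu (cover Φ₀ z))) ∧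
      ∀ z : Fin g → ℂ, ex (u, z) = π (L z) := by
    intro u hu
    obtain ⟨Φ₀, π, φu, hπd, hπinj, hπ0, hbpπ, hker, hsurj, h2π, han, hadd, hread⟩ := hfib u
    -- the fibre map `f = ex (u, ·)`
    have hfd : MDifferentiable 𝓘(ℂ, Fin g → ℂ) 𝓘(ℂ, Fin (d + g) → ℂ) (fun z : Fin g → ℂ => ex (u, z)) := by
      have hincl : ContMDiff 𝓘(ℂ, Fin g → ℂ) (𝓘(ℂ, Fin d → ℂ).prod 𝓘(ℂ, Fin g → ℂ)) ω
          (fun z : Fin g → ℂ => ((u, z) : MS × (Fin g → ℂ))) :=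
        contMDiff_const.prodMk contMDiff_id
      have hcomp : ContMDiff 𝓘(ℂ, Fin g → ℂ) 𝓘(ℂ, Fin (d + g) → ℂ) ω (ex ∘ fun z : Fin g → ℂ => ((u, z) : MS × (Fin g → ℂ))) :=
        hexω.comp_contMDiff hincl fun z => ⟨hu, mem_univ _⟩
      exact hcomp.mdifferentiable (by simp)
    have hf0 : (fun z : Fin g → ℂ => ex (u, z)) 0 = π 0 := by
      simp only [hex0 u hu, hπ0]
    have h2f : ∀ z : Fin g → ℂ, two ((fun z : Fin g → ℂ => ex (u, z)) z) = (fun z : Fin g → ℂ => ex (u, z)) ((2 : ℂ) • z) :=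
      fun z => h2ex u hu z
    have hrange : ∀ z : Fin g → ℂ, ∃ w : Fin g → ℂ, (fun z : Fin g → ℂ => ex (u, z)) z = π w := by
      intro z
      obtain ⟨w, hw⟩ := hsurj (ex (u, z)) (hbp_ex u hu z)
      exact ⟨w, hw.symm⟩
    have hinjOn : ∃ ρ' > 0, InjOn (fun z : Fin g → ℂ => ex (u, z)) (Metric.ball (0 : Fin g → ℂ) ρ') := by
      refine ⟨ρ, hρ, fun z hz z' hz' hzz' => ?_⟩
      have hq : (u, z) ∈ Θ.target := hUρ ⟨hu, hz⟩
      have hq' : (u, z') ∈ Θ.target := hUρ ⟨hu, hz'⟩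
      have heq : Θ.symm (u, z) = Θ.symm (u, z') := by
        have h1 := hexΘ u hu z hz
        have h2 := hexΘ u hu z' hz'
        simp only at hzz'
        rw [← h1, ← h2, hzz']
      exact (Prod.mk.inj (Θ.symm.injOn hq hq' heq)).2
    obtain ⟨L, hL⟩ :=
      Literature.Geometry.Kaehler.ComplexTorusDoublingEquivariantLift.exists_linear_of_doubling_equivariant g (d + g) MA two π (fun z : Fin g → ℂ => ex (u, z)) Φ₀ hπd hπinj hker h2π hfd hf0 h2f
      hrange hinjOn
    exact ⟨Φ₀, π, φu, L, hker, hsurj, han, hadd, hread, hL⟩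
  refine ⟨U, hmU, ex, hUopen, hexω, hbp_ex, ?_, hexbij, ?_, ?_⟩
  · -- normalisation: the (G)-reading at `z = 0`
    intro u hu
    obtain ⟨Φ₀, π, φu, L, -, -, -, hadd, hread, hL⟩ := hlin u hu
    have hφ0 : φu 0 = 1 := by
      have h := hadd 0 0
      rw [add_zero] at h
      have h' : φu 0 * φu 0 = φu 0 * 1 := by rw [mul_one]; exact h.symm
      exact mul_left_cancel h'
    have hc0 : cover Φ₀ (0 : Fin g → ℂ) = 0 := Literature.Geometry.Kaehler.ComplexTorus.cover_zero Φ₀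
    rw [hL, map_zero, hread, hc0, hφ0]
  · -- translation law
    intro u hu z z'
    obtain ⟨Φ₀, π, φu, L, hker, -, -, -, -, hL⟩ := hlin u hu
    rw [hL, hL, hL, hL, hker, eq_comm, hker]
    simp only [map_sub, map_zero, zero_add]
    constructor
    · rintro ⟨k, hk⟩
      exact ⟨k, by rw [hk]; abel⟩
    · rintro ⟨k, hk⟩
      exact ⟨k, by rw [← hk]; abel⟩
  · -- onto the fibres
    intro a ha
    obtain ⟨Φ₀, π, φu, L, -, hsurj, -, -, -, hL⟩ := hlin _ ha
    obtain ⟨w, hw⟩ := hsurj a rfl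
    exact ⟨L.symm w, by rw [hL, ContinuousLinearEquiv.apply_symm_apply, hw]⟩

end Literature.Geometry.ComplexAnalytic

end
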